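import Summits.ABC.StewartYu.PadicW80SizesLC
import Summits.ABC.StewartYu.PadicW80NumericLB
import Summits.ABC.StewartYu.PadicW80ParLEnvelope
import Summits.ABC.ABC.Theorems.PadicPrincipalCoreST86TheoremA
import HarnessLib

/-!
# Theorem A with the `(log p)^{m−1}` normalisation: the `ℓ`-ledger closes end to end

`Summits/ABC/StewartYu/PadicCW77TheoremALogNormalised.lean` — cell `abc-stewartyu` (seat p1, stub S5 of
memo-03 §4 / planner kill-test G2b.1; theorems + one closed-form integer bound, no named fact).

The landed Theorem A (`Summit.ABC.StewartYu.theoremAShape_holds`, p3/p2/p1) is the `p`-adic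
Cijsouw–Waldschmidt/Waldschmidt descent for principal units with the `p`-FREE numerics (`log p ↦ log 3` in the
Schwarz branch of `KFinal`), i.e. `SymmBound C r` with `r = 0`. This file re-runs the SAME machine
(`PadicCW77Main.main` via `ParamPack`) on p1's `ℓ`-normalised parameter record `PadicW80ParL`
(`ℓ = log p`, `Mcl = 1`, `W ↦ max(W, log p)`): every input of p2's `main` is discharged from the `ℓ`-threaded
numerics (`PadicW80ParL{A–F}`, `PadicW80NumericL{,B}`, `PadicW80BudgetsL`, `PadicW80SizesL{,H,B,C}`,
`PadicW80SizesLC` incl. the closed-form `KSizes/Siegel/Endgame/HSizesHalf`), and the envelope `U ≤ 2·Cw(m)·(∏Vⱼ)V_θ·(W' + log 2V_max)·log(2V_max)/ℓ^{m}`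
(`PadicW80ParLEnvelope`) gives

* `coreBound_logNormalised : CoreBound (fun m => 4 * Cw m) (fun m => m - 1)` and
* **`symmBound_logNormalised : SymmBound (fun m => 8 * Cw m) (fun m => m - 1)`** — Theorem A for principal
  units with `ord_p(Θ − 1)·log p ≤ 8·(2⁶⁹m)ᵐ·(∏Vⱼ)·(W + log 2V_max)·log(2V_max)/(log p)^{m−1}`, i.e. the
  landed bound divided by `(log p)^{m−1}` (one factor `log p` is spent on `W ↦ max(W, log p)`; with the floor
  `log p ≤ W` as a hypothesis the exponent is `m`, `PadicW80ParL.U_le_Cw_div`).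

For the M2 twist engines this is the kernel check of the whole `(log p)` ledger (design note
HOME/p1/S5-logp-ledger.md): the twist set-up changes only `Setup`-level bookkeeping and the class price
`Mcl = (p−1)/2`, which the record already carries (`padic_siegel_count_real`, `U_le_Cw'`).

## References
* [Yu1990] K. Yu, *Linear forms in p-adic logarithms II*, Compositio Math. 74 (1990), Theorem 2.1, (2.30)–(2.31).
* [Waldschmidt1980] M. Waldschmidt, Acta Arith. 37 (1980), Prop. 3.8 (p. 263), §3 (pp. 264–274).
-/

noncomputable section

/-! ## Part 1 — the parameter pack at the `ℓ`-normalised record, all inputs discharged -/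

open Finset
open Literature.NumberTheory.Transcendental
open Literature.NumberTheory.Transcendental.CW77 (heightProd hgt)
open Literature.NumberTheory.Transcendental.CW77.Setup (Idx Tau tauNorm)

namespace Literature.NumberTheory.Transcendental.PadicCW77.Setup

open Summit.ABC.StewartYu
open Summit.ABC.StewartYu.PadicW80Par (cLp')

variable (S : PadicCW77.Setup)

/-- The integer coefficient bound of Siegel's step at the `ℓ`-normalised record: `⌈#box₀ · 𝔅⁴ E(2)⌉`.
[folklore] -/
def PintL (P : PadicW80ParL S.d) : ℤ :=
  ⌈((S.frame.box (h := P.hparℓ) (Lb := P.Lbℓ) P.Lℓ P.Lθℓ 0).card : ℝ) * (P.𝔅ℓ ^ 4 * P.Efacℓ 2)⌉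

/-- `PintL ≤ PrV = 2·𝔅⁵E(2)` (`#box₀ ≤ 𝔅`). [folklore] -/
theorem PintL_le_PrVℓ (P : PadicW80ParL S.d) : (S.PintL P : ℝ) ≤ P.PrVℓ := by
  classical
  unfold PintL PadicW80ParL.PrVℓ
  have hcard : ((S.frame.box (h := P.hparℓ) (Lb := P.Lbℓ) P.Lℓ P.Lθℓ 0).card : ℝ) ≤ P.𝔅ℓ :=
    S.toQ.flat.card_box_le_𝔅_pℓ P 0
  have hE := P.Efacp_pos 2
  have hA0 : 0 ≤ P.𝔅ℓ ^ 4 * P.Efacℓ 2 := by have := P.𝔅_pos; positivity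
  have hA1 : 1 ≤ P.𝔅ℓ ^ 5 * P.Efacℓ 2 :=
    one_le_mul_of_one_le_of_one_le (one_le_pow₀ P.one_le_𝔅) (P.one_le_Efacp (by norm_num))
  have h1 : ((S.frame.box (h := P.hparℓ) (Lb := P.Lbℓ) P.Lℓ P.Lθℓ 0).card : ℝ) * (P.𝔅ℓ ^ 4 * P.Efacℓ 2) ≤
      P.𝔅ℓ ^ 5 * P.Efacℓ 2 := by
    calc ((S.frame.box (h := P.hparℓ) (Lb := P.Lbℓ) P.Lℓ P.Lθℓ 0).card : ℝ) * (P.𝔅ℓ ^ 4 * P.Efacℓ 2)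
        ≤ P.𝔅ℓ * (P.𝔅ℓ ^ 4 * P.Efacℓ 2) := mul_le_mul_of_nonneg_right hcard hA0
      _ = P.𝔅ℓ ^ 5 * P.Efacℓ 2 := by ring
  have h2 := Int.ceil_lt_add_one (((S.frame.box (h := P.hparℓ) (Lb := P.Lbℓ) P.Lℓ P.Lθℓ 0).card : ℝ) *
    (P.𝔅ℓ ^ 4 * P.Efacℓ 2))
  linarith

/-- **The `p`-adic parameter pack at the `ℓ`-normalised record** (`ℓ = log p`), every input of p2's `main`
discharged from the height link, Kummer-freeness and the `(log p)`-threaded numerics — the two `KFinal`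
inequalities in TRUE `log p` form (`kstep_ineq_one/two`), not through `kFinal_of_pfree_ineq`. [folklore] -/
def paramPackOfL {P : PadicW80ParL S.d} (hy : S.toQ.flat.SizeHyp P.V P.Vθ P.W)
    (hind : ∀ T' : Finset (Fin (S.d + 1)), T'.Nonempty → ¬ IsSquare (∏ i ∈ T', S.all i))
    (hℓp : P.ℓ = Real.log S.p) : S.ParamPack P.Uℓ where
  h := P.hparℓ
  Lb := P.Lbℓ
  J₀ := P.J₀ℓ
  L := P.Lℓ
  Lθ := P.Lθℓ
  S₀ := P.S₀ℓ
  T := P.Tℓ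
  P := S.PintL P
  t := P.tJℓ
  Dmax := fun _ k => P.DmaxKℓ k
  Mmax := fun _ k => P.MmaxKℓ k
  hS₀ := P.even_S₀
  ht := fun _ hJ => P.one_le_tJ hJ
  htT := fun J _ => by have := P.tJ_mul_le J; nlinarith
  hUp := P.log_p_le_U (le_of_eq hℓp.symm)
  hsz := fun J hJ p inv => kSizes_of_hypℓ hy hJ (P.tJℓ J) (S.PintL_le_PrVℓ P) inv
  hfin := fun hΛ J hJ =>
    S.kFinal_of_log_ineq J P.S₀ℓ (P.tJℓ J) (fun k => P.DmaxKℓ k) (fun k => P.MmaxKℓ k) hΛ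
      (fun k _ => ⟨P.DmaxK_pos k, P.MmaxK_pos k⟩)
      (fun k hk => P.kstep_ineq_one S.hp3 hℓp hJ hk (P.logDM_le_budget k))
      (fun k hk => P.kstep_ineq_two S.hp3 hℓp hJ hk (P.logDM_le_budget k))
  hhalf := fun hΛ J hJ => by
    have hp0 : (0 : ℝ) < S.p := by exact_mod_cast S.hp.pos
    have hΛ' : ‖S.Λ₀‖ ≤ (S.p : ℝ)⁻¹ := by
      refine hΛ.trans ?_
      rw [← Real.exp_log hp0, ← Real.exp_neg, Real.exp_le_exp]
      exact neg_le_neg (P.log_p_le_U (le_of_eq hℓp.symm))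
    have hroom : P.Tℓ / 2 ^ (J + 1) + P.tJℓ J ≤ P.Tℓ / 2 ^ J - S.d * P.tJℓ J := by
      have h2 := P.room_half J
      have e1 : (S.d + 1) * P.tJℓ J = S.d * P.tJℓ J + P.tJℓ J := by ring
      rw [e1] at h2
      omega
    -- the height product against the sizes
    have hH1 : 1 ≤ heightProd S.all := CW77.one_le_heightProd _
    have hH : heightProd S.all ≤ Real.exp ((∑ j, P.V j) + P.Vθ) := by
      have h1 := hy.heightProd_le
      rw [S.toQ.heightProd_flat_all, CW77.Setup.SizeHyp.sum_snoc] at h1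
      exact h1
    refine S.halfStep_of hJ hind hΛ' (P.one_le_tJ hJ) P.even_S₀ hroom
      (hSizesHalf_of_hypℓ hy hJ (S.PintL_le_PrVℓ P)) ?_
    exact S.hFinalHalf_of_log_ineq J P.S₀ℓ (P.tJℓ J) hΛ (by linarith [P.one_le_DmaxHp])
      (by linarith [P.one_le_MmaxHp])
      (P.halfstep_ineq_one S.hp3 hℓp hJ (P.bhalf_le_budget hH1 hH))
      (P.halfstep_ineq_two S.hp3 hℓp hJ (P.bhalf_le_budget hH1 hH))
  hsiegel := siegel_of_hypℓ hy
  hend := endgame_of_paramsℓ P _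

/-- **`‖Λ₀‖_p > e^{−U}` at the `ℓ`-normalised record** — p2's `norm_Λ₀_gt_of_paramPack` on `paramPackOfL`.
[folklore] -/
theorem norm_Λ₀_gtL {P : PadicW80ParL S.d} (hy : S.toQ.flat.SizeHyp P.V P.Vθ P.W)
    (hind : ∀ T' : Finset (Fin (S.d + 1)), T'.Nonempty → ¬ IsSquare (∏ i ∈ T', S.all i))
    (hℓp : P.ℓ = Real.log S.p) : Real.exp (-P.Uℓ) < ‖S.Λ₀‖ :=
  S.norm_Λ₀_gt_of_paramPack (S.paramPackOfL hy hind hℓp)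

end Literature.NumberTheory.Transcendental.PadicCW77.Setup

/-! ## Part 2 — the core bound and Theorem A with `r(m) = m − 1` -/

open Finset
open Literature.NumberTheory.Transcendental
open Literature.NumberTheory.Transcendental.PadicCW77

namespace Summit.ABC.StewartYu

/-- **Packs exist at the `(log p)^{d}`-normalised exponent** for every signed Kummer-free set-up with `d ≥ 1`:
the record is `(V, V_max, V_θ, max(W, log p), ℓ = log p, Mcl = 1)`, the pack is `paramPackOfL` (monotone in `U`), and
`U ≤ 2·Cw·(∏V)V_θ·(max(W, log p) + L)·L/(log p)^{d+1} ≤ 4·Cw·(∏V)V_θ·(W + L)·L/(log p)^{d}` (`L = log 2V_max`).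
[folklore] -/
def packOfL (S : PadicCW77.Setup) (V : Fin S.d → ℝ) (Vθ Vmax W : ℝ) (hd : 1 ≤ S.d)
    (hK : ∀ T : Finset (Fin (S.d + 1)), T.Nonempty → ¬ IsSquare (∏ i ∈ T, S.all i))
    (_hμ : ∀ μ : Fin (S.d + 1) → ℤ, ∏ i, S.all i ^ μ i = 1 → μ = 0)
    (hV : ∀ j, Height.logHeight₁ (S.α j) ≤ V j) (hVθ : Height.logHeight₁ S.θ ≤ Vθ)
    (hVp : ∀ j, Real.log S.p ≤ V j) (hVθp : Real.log S.p ≤ Vθ) (hVm : ∀ j, V j ≤ Vmax) (hVθm : Vθ ≤ Vmax)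
    (hW : ∀ j, Real.log (max 3 (|S.b j| : ℝ)) ≤ W) (hWθ : Real.log (max 3 (|S.bθ| : ℝ)) ≤ W) :
    S.ParamPack (4 * PadicW80Par.Cw (S.d + 1) * ((∏ j, V j) * Vθ) * (W + Real.log (2 * Vmax)) *
      Real.log (2 * Vmax) / Real.log S.p ^ S.d) := by
  -- `1 < log 3 ≤ log p`
  have hlog3 : (1 : ℝ) < Real.log 3 := by
    rw [Real.lt_log_iff_exp_lt (by norm_num)]
    have := Real.exp_one_lt_d9; norm_num at this; linarith
  have hlp : (1 : ℝ) ≤ Real.log S.p :=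
    hlog3.le.trans (Real.log_le_log (by norm_num) (by exact_mod_cast S.hp3))
  have hW1 : (1 : ℝ) ≤ W := by
    have h3 : Real.log 3 ≤ Real.log (max 3 (|S.bθ| : ℝ)) :=
      Real.log_le_log (by norm_num) (le_max_left _ _)
    linarith [hWθ]
  set ℓ : ℝ := Real.log S.p with hℓ
  set W' : ℝ := max W ℓ with hW'
  let P : PadicW80ParL S.d :=
    { V := V, Vm := Vmax, Vθ := Vθ, W := W', ℓ := ℓ, Mcl := 1
      hℓ := hlp
      hVℓ := hVp
      hVmax := hVm
      hVθℓ := hVθp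
      hVθmax := hVθm
      hWℓ := le_max_right _ _
      hMcl := le_rfl
      hMclℓ := by rw [Real.log_one]; linarith
      hd := hd }
  have hW' : ∀ j, Real.log (max 3 (|S.b j| : ℝ)) ≤ W' := fun j => (hW j).trans (le_max_left _ _)
  have hWθ' : Real.log (max 3 (|S.bθ| : ℝ)) ≤ W' := hWθ.trans (le_max_left _ _)
  have pk := S.paramPackOfL (P := P) (S.sizeHyp_of_logHeight hV hVθ hW' hWθ') hK rfl
  refine pk.mono ?_
  -- `P.U ≤ 2·1·Cw·(∏V)Vθ·(W' + L)·L/ℓ^{d+1} ≤ 4·Cw·(∏V)Vθ·(W + L)·L/ℓ^d`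
  have hU := P.U_le_Cw_div
  set L : ℝ := Real.log (2 * Vmax) with hL
  have hVm1 : 1 ≤ Vmax := (hlp.trans hVθp).trans hVθm
  have hL0 : 0 < L := by rw [hL]; exact Real.log_pos (by linarith)
  have hCw : 0 ≤ PadicW80Par.Cw (S.d + 1) := le_trans (by norm_num) (PadicW80Par.two_le_Cw (by omega))
  have hprod : 0 ≤ (∏ j, V j) * Vθ := by
    have : 0 ≤ ∏ j, V j := prod_nonneg fun j _ => le_trans (by linarith) (hVp j)
    have : 0 ≤ Vθ := by linarith
    positivity
  have hℓ0 : 0 < ℓ := by linarith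
  -- `(W' + L)/ℓ ≤ 2 (W + L)`: `W' ≤ W + ℓ`, `W + L ≥ 1`, `ℓ ≥ 1`
  have hWL : W' + L ≤ 2 * (W + L) * ℓ := by
    have h1 : W' ≤ W + ℓ := max_le (by linarith) (by linarith)
    nlinarith
  have key : 2 * (1 : ℝ) * PadicW80Par.Cw (S.d + 1) * ((∏ j, V j) * Vθ) * (W' + L) * L / ℓ ^ (S.d + 1) ≤
      4 * PadicW80Par.Cw (S.d + 1) * ((∏ j, V j) * Vθ) * (W + L) * L / ℓ ^ S.d := by
    rw [pow_succ, div_le_div_iff₀ (by positivity) (by positivity)]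
    have h0 : 0 ≤ PadicW80Par.Cw (S.d + 1) * ((∏ j, V j) * Vθ) * L * ℓ ^ S.d := by positivity
    calc 2 * (1 : ℝ) * PadicW80Par.Cw (S.d + 1) * ((∏ j, V j) * Vθ) * (W' + L) * L * ℓ ^ S.d
        = 2 * (W' + L) * (PadicW80Par.Cw (S.d + 1) * ((∏ j, V j) * Vθ) * L * ℓ ^ S.d) := by ring
      _ ≤ 2 * (2 * (W + L) * ℓ) * (PadicW80Par.Cw (S.d + 1) * ((∏ j, V j) * Vθ) * L * ℓ ^ S.d) := by
          gcongr
      _ = 4 * PadicW80Par.Cw (S.d + 1) * ((∏ j, V j) * Vθ) * (W + L) * L * (ℓ ^ S.d * ℓ) := by ring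
  exact hU.trans key

/-- **The core bound with the `(log p)^{m−1}` normalisation**: for every signed Kummer-free set-up,
`‖Λ₀‖_p > exp(−4·Cw(m)·(∏Vⱼ)V_θ·(W + log 2V_max)·log(2V_max)/(log p)^{m−1})`, `m = d + 1`.
[cite: Yu1990, Theorem 2.1] [cite: Waldschmidt1980, Prop. 3.8 (p. 263)] -/
theorem coreBound_logNormalised : CoreBound (fun m => 4 * PadicW80Par.Cw m) (fun m => m - 1) := by
  refine coreBound_of_paramPack_pos (r := fun m => m - 1) rfl ?_ ?_
  · have := PadicW80Par.two_le_Cw (le_refl 1); linarith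
  · intro S V Vθ Vmax W hd hK hμ hV hVθ hVp hVθp hVm hVθm hW hWθ
    have e : (S.d + 1 - 1 : ℕ) = S.d := by omega
    rw [e]
    exact packOfL S V Vθ Vmax W hd hK hμ hV hVθ hVp hVθp hVm hVθm hW hWθ

/-- **THEOREM A WITH THE `(log p)^{m−1}` NORMALISATION** (principal units, the cell's `SymmBound` clothing):
for an odd prime `p`, principal units `αⱼ ≡ 1 (mod p)` of `ℚ`, multiplicatively independent and Kummer-free,
heights `h(αⱼ) ≤ Vⱼ`, `log p ≤ Vⱼ ≤ V_max`, `log max(3,|bⱼ|) ≤ W`, `b ≠ 0`: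
`ord_p(∏ αⱼ^{bⱼ} − 1) · log p ≤ 8·(2⁶⁹ m)ᵐ · (∏ Vⱼ) · (W + log 2V_max) · log(2V_max) / (log p)^{m−1}` —
the landed Theorem A (`theoremAShape_holds`, `r = 0`) sharpened by the factor `(log p)^{m−1}` that the `p`-free
numerics gave away; in Yu's units `ord_p Θ ≪ (cm)ᵐ·∏(Vⱼ/log p)·(W + log V_max)·log V_max`.
[cite: Yu1990, Theorem 2.1 and (2.30)] [cite: Waldschmidt1980, Prop. 3.8 (p. 263)] -/
theorem symmBound_logNormalised : SymmBound (fun m => 2 * (4 * PadicW80Par.Cw m)) (fun m => m - 1) :=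
  symmBound_of_coreBound (fun _ hm => by have := PadicW80Par.two_le_Cw hm; linarith) (fun m => Nat.sub_le m 1)
    coreBound_logNormalised

end Summit.ABC.StewartYu

end
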